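import Summits.QuantumFields.YangMills.Theses.ConvexGribovBody
import Summits.QuantumFields.YangMills.Theorems.PoincareToGap.Negative.Tightness
import Summits.QuantumFields.YangMills.Theorems.PoincareToGap.Negative.PlaquetteVariance
import Literature.MathematicalPhysics.QuantumLattice.GaugeGroups
import Literature.MathematicalPhysics.QuantumLattice.GrassmannIntegral
import Literature.AlgebraicTopology.FundamentalGroup.CircleValuedLift
import Literature.AlgebraicTopology.FundamentalGroup.RotationGroupSO3
import HarnessLib

/-!
# Disproof of `NonSimplyConnectedLatticeGap` — findings of the standing disprover (cycle 1, 2026-08-16)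

Crux `stmt-QuantumFields-16405`,
`Summit.QuantumFields.YangMills.Theses.ConvexGribovBody.NonSimplyConnectedLatticeGap`
(route `ConvexGribovBody`, rank 6): for every compact simple `G` with `¬ SimplyConnectedSpace G`
and every faithful unitary lattice representation `r` there is `β₀` with: for all `β ≥ β₀` there
are `m > 0`, `S₁` such that for all gauge-invariant local observables `A B` there is `C` with
`|corr_S(A,B,n)| ≤ C e^{-m n}` on every torus `(2S+1)⁴`, `S ≥ S₁`, `n ≤ S`
(`corr = latticeConnectedCorr r.ρ β (2S+1) A.F B.F n`, Wilson's measure at coupling `β`).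

VERDICT OF THIS CYCLE: **no kill; the crux is the weak-coupling volume-uniform lattice mass gap for
the adjoint-type groups (SO(3), PSU(N), …), an open problem believed TRUE.** Every definition in
its cone is faithful (Wilson measure = normalised `e^{-β S_W}` × product Haar, a probability
measure for continuous `ρ`; `YMSpecies` = bounded measurable gauge-invariant cylinder functions;
periodic lift; time shift `configShift (-n e₀)`), no junk value is reachable (`NeZero (2S+1)`,
`n : ℕ` cast inside `exp`, `|corr| ≤ 2‖A‖∞‖B‖∞ < ∞`), and no junk MODEL of the hypotheses exists:
`IsCompactSimpleLieGroup G ∧ ¬ SimplyConnectedSpace G` with a faithful continuous unitary matrix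
representation forces `G` Hausdorff, second countable, a compact connected Lie group with simple
Lie algebra and non-trivial `π₁` — exactly `G̃/Z`, `Z ≠ 1` central (§A3 records that `U(1)` passes
every clause except non-abelianness, and that finite groups pass every clause except
connectedness). What is kernel-checked here (all `sorry`-free unless marked NEAR-MISS):

* §0  `body_iff` — the verbatim body ↔ the tree decl (`Iff.rfl`); `of_uniformLatticeGap` — the crux
  is the rank-0 target restricted to `π₁ ≠ 0` (no content is specific to `¬ SimplyConnectedSpace`).
* §A  LOAD-BEARING HYPOTHESES.
  - A1 `n ≤ S` is load-bearing, UNCONDITIONALLY, for EVERY admissible `(G, r)` and every `β₀`: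
    `false_without_timeBound_at` (periodicity `corr_S(n + (2S+1)) = corr_S(n)` plus the
    volume-uniform plaquette variance bound of `PoincareToGap.Negative`, imported — same clustering
    body). Any proof must use `n ≤ S`; the thermal wrap-around `e^{-m(2S+1-n)} ≤ e^{-m(n+1)}` is
    what `n ≤ S` buys.
  - A2 `S₁ ≤ S` is NOT load-bearing: `clustering_iff_noS₁` — the body with `S₁` deleted is
    EQUIVALENT (finitely many `(S, n)` with `n ≤ S < S₁` are absorbed into `C(A,B)`); the femto-
    universe is not excluded by `S₁`, it is merely harmless because `n ≤ S`.
  - A3 the NON-ABELIAN clause of `IsSimpleCompactGroup` is load-bearing modulo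
    `U1WilsonTorusMasslessD4` (Guth / Fröhlich–Spencer photon masslessness, Wilson-action torus form —
    open as stated, printed for the Villain action): `false_without_nonAbelian_of_u1Massless`.
    Kernel-checked on the way: `U(1) = Circle` is connected, satisfies the closed-connected-normal-
    subgroup clause (`circle_subgroup_eq_bot_or_top`), is NOT simply connected
    (`not_simplyConnectedSpace_circle`) and carries the faithful unitary `u1Rep` — so the crux's
    hypotheses exclude the abelian Coulomb phase ONLY through `∃ a b, a * b ≠ b * a`.
  - A4 `¬ SimplyConnectedSpace G` is a RESTRICTION, not a hypothesis a proof can use: the intended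
    witness class is non-empty at the level of topology (`not_simplyConnectedSpace_SO3`, from the
    tree's `π₁(SO(3)) = ℤ/2`); dropping it gives the rank-0 target.
  - A5 (docstring analysis only) connectedness: dropping it admits exactly the FINITE non-abelian
    groups (a compact Lie group whose identity component is trivial), whose large-`β` phase is
    massive (Adhikari–Cao arXiv:2202.10375 Thm 1; tree: `ZnTorusClusteringD4_holds` for `ℤ_n`) — not
    a falsity witness. Faithfulness of `r`: dropping it admits the trivial representation (product
    Haar measure, `corr = 0` beyond the supports) — trivially TRUE instances, not a witness. The
    simplicity clause: dropping it admits `U(1) × SU(2)` with `r = ρ₁ ⊕ ρ_fund`, whose Wilson action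
    splits, so the `U(1)` factor is the A3 witness again (needs product-Haar factorisation; not built).
    `β₀ ≤ β`: dropping it meets the first-order bulk transition of `SO(3)` at `β_A ≈ 2.5`
    (HallidaySchwimmer1981, BhanotCreutz1981: torus phase coexistence ⇒ no clustering at `β_c`) —
    physics, no theorem.
* §B  TIGHTNESS / TRIVIAL VARIANTS. B1 `perVolume_trivial` — with `C` allowed to depend on `S` the
  body holds for EVERY `G, r, β, m` (the whole content is the `S`-uniformity of `C(A,B)`).
  B2 `no_uniform_constant` — the natural strengthening "one `C` for all `A, B`" is false for every
  admissible `(G, r)`, `β`, `m`, `S₁` (scaling `A ↦ λ A` against the uniform plaquette variance):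
  `C(A,B)` must scale like `‖A‖∞ ‖B‖∞`.
* §C  STRENGTHENINGS not decided here: `∃ m` before `∀ β` (β-uniform rate) is false iff
  `ξ(β) → ∞` (asymptotic freedom; no tree theorem); clustering for ALL `β ≥ 0` meets the bulk
  transitions (A5).
* §D  TARGETS (lead's skeleton, PICKED = Sketch): `stub_sectorIdentity` CHECKED TRUE by hand incl.
  null parts (algebra in the comment of §D); `stub_cellAnalyticityNSC` is crux-strength (π₁ ≠ 0
  restriction of item 16178), no cheap attack beyond the crux itself; `stub_cruxOf…` is proved in
  the skeleton. No stub is attackable by small models: every stub quantifies over the same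
  uninstantiable-in-tree class of groups.
* §E  PRINT: no negative result for SO(3)-type Wilson theories at large `β` exists
  (de Forcrand–Jahn hep-lat/0211004 resolve the Datta–Gavai anomaly inside twist sectors;
  grounder/attacker notes); the only rigorous weak-coupling clustering in `d = 4` is for finite `G`.

WHY IT RESISTS: a refutation needs a non-simply-connected compact simple `G`, a faithful `r` and,
at arbitrarily large `β`, a pair of local observables whose torus time-correlation does not decay
volume-uniformly — i.e. a massless or phase-coexisting weak-coupling phase of 4-d `SO(3)`-type
lattice Yang–Mills, contradicting universally expected (and numerically observed) confinement with
a gap; formally, even `IsSimpleCompactGroup SO(3)` is not in the tree. Bounded-`β` phenomena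
(bulk transitions, Bhanot–Creutz windows, femto-universe sector splitting at `S ≲ ξ(β)`) never
bite because `β₀` is chosen after `r` and `S₁`, `C` after `β`; in the confined regime `S ≫ ξ(β)`
the twist-sector spread of a local expectation is `O(L⁻⁴ ∂_β(L² e^{-ρL²}))`, far below `e^{-mS}`.

LANDED IN THE TREE (accepted, importable; namespace
`Summit.QuantumFields.YangMills.Theorems.NonSimplyConnectedLatticeGap.Negative`):
* `Negative/FalseWithoutTimeBound.lean` (p124084) — `nonSimplyConnectedLatticeGap_false_without_timeBound_at` (= A1);
* `Negative/Tightness.lean` (p124137) — `abs_le_sum_mul_exp`, `perVolume_clustering_trivial` (= B1),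
  `clustering_iff_noS₁` (= A2), `latticeConnectedCorr_smul`, `no_uniform_clustering_constant` (= B2);
* `Negative/FalseWithoutNonAbelianOfU1Massless.lean` (p124178) — `circle_subgroup_eq_bot_or_top`,
  `not_simplyConnectedSpace_circle`, `circle_passes_all_but_nonAbelian`,
  `nonSimplyConnectedLatticeGap_false_without_nonAbelian_of_u1Massless` (= A3, hypothesis inline).
This work file keeps self-contained copies (namespace `…Cruxes.NonSimplyConnectedLatticeGap.Disproof`)
so that it elaborates on farm nodes serving an older tree; prefer the landed names downstream.
Literature this cycle: searchd / OpenAlex / S2 degraded (connection reset, HTTP 429), zbMATH only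
(de Forcrand–Jahn hep-lat/0211004, hep-lat/0209060: SU(2)-like physics inside each twist sector) —
the attacker's and grounder's searches of 2026-08-16 (17 queries, 2 papers page-read) stand.
-/

noncomputable section

open MeasureTheory Filter Topology Function
open Literature.MathematicalPhysics.QuantumFieldTheory
open Literature.MathematicalPhysics.QuantumLattice (torusLift configShift configShift_apply torusEdge
  LGConfig LocalGaugeObservable IsSimpleCompactGroup u1Rep continuous_u1Rep u1Rep_injective
  u1Rep_mem_unitaryGroup)

namespace Summit.QuantumFields.YangMills.Cruxes.NonSimplyConnectedLatticeGap.Disproof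

/-! ## §0 The statement -/

/-- The verbatim body of the crux IS the tree decl (read-back check). -/
theorem body_iff :
    (∀ (G : Type) [Group G] [TopologicalSpace G] [IsTopologicalGroup G] [CompactSpace G]
      [MeasurableSpace G] [BorelSpace G], IsCompactSimpleLieGroup G → ¬ SimplyConnectedSpace G →
      ∀ r : LatticeRep G, ∃ β₀ : ℝ, ∀ β : ℝ, β₀ ≤ β → ∃ m : ℝ, 0 < m ∧ ∃ S₁ : ℕ,
      ∀ A B : YMSpecies G, ∃ C : ℝ, ∀ S n : ℕ, S₁ ≤ S → n ≤ S →
      |latticeConnectedCorr r.ρ β (2 * S + 1) A.F B.F n| ≤ C * Real.exp (-(m * n))) ↔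
    Summit.QuantumFields.YangMills.Theses.ConvexGribovBody.NonSimplyConnectedLatticeGap :=
  Iff.rfl

/-- The crux is the rank-0 target `UniformLatticeGap` restricted to `π₁(G) ≠ 0`: the hypothesis
`¬ SimplyConnectedSpace G` is discarded. (Also in the one-shot attacker's W2.lean.) -/
theorem of_uniformLatticeGap
    (h : Summit.QuantumFields.YangMills.Theses.ConvexGribovBody.UniformLatticeGap) :
    Summit.QuantumFields.YangMills.Theses.ConvexGribovBody.NonSimplyConnectedLatticeGap :=
  fun G _ _ _ _ _ _ hG _ r => h G hG r

/-! ## §A1 `n ≤ S` is load-bearing (unconditional, every admissible `(G, r)`) -/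

section TimeBound

variable {G : Type} [Group G] [TopologicalSpace G] [IsTopologicalGroup G] [CompactSpace G]
  [MeasurableSpace G] [BorelSpace G]

omit [MeasurableSpace G] [BorelSpace G] [IsTopologicalGroup G] [TopologicalSpace G]
  [CompactSpace G] in
/-- A compact simple Lie group in the crux's sense is non-abelian, hence has an element `≠ 1`.
[folklore] -/
theorem exists_ne_one [TopologicalSpace G] [CompactSpace G] (hG : IsCompactSimpleLieGroup G) :
    ∃ a : G, a ≠ 1 := by
  obtain ⟨-, ⟨a, b, hab⟩, -⟩ := hG.1
  exact ⟨a, fun ha => hab (by rw [ha, one_mul, mul_one])⟩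

/-- **A1. The restriction `n ≤ S` is load-bearing — for EVERY admissible `(G, r)` and every
`β₀`.** The crux body with `n ≤ S` deleted (clustering demanded at all separations `n` on the
torus of period `2S+1`) fails: by periodicity `corr_S(A,A,k(2S+1)) = corr_S(A,A,0) = Var_S(A)`,
and the plaquette has variance `≥ v(β) > 0` uniformly in `S ≥ 1`
(`PoincareToGap.Negative.exists_cov_lower_bound`). Only `∃ a ≠ 1` of `IsCompactSimpleLieGroup`
is used; `¬ SimplyConnectedSpace` is not needed. [folklore] -/
theorem false_without_timeBound_at (hG : IsCompactSimpleLieGroup G) (r : LatticeRep G) :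
    ¬ (∃ β₀ : ℝ, ∀ β : ℝ, β₀ ≤ β → ∃ m : ℝ, 0 < m ∧ ∃ S₁ : ℕ, ∀ A B : YMSpecies G, ∃ C : ℝ,
      ∀ S n : ℕ, S₁ ≤ S →
      |latticeConnectedCorr r.ρ β (2 * S + 1) A.F B.F n| ≤ C * Real.exp (-(m * n))) := by
  rintro ⟨β₀, h⟩
  obtain ⟨g₀, hg₀⟩ := exists_ne_one hG
  obtain ⟨A, v, hv, hA⟩ := Summit.QuantumFields.YangMills.Theorems.PoincareToGap.Negative.exists_cov_lower_bound r hg₀ β₀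
  exact Summit.QuantumFields.YangMills.Theorems.PoincareToGap.Negative.not_clusteringAllSep_of_cov_lower_bound
    r β₀ A A hv
    (fun S₁ => ⟨max S₁ 1, le_max_left _ _, hA _ (le_max_right _ _)⟩) (h β₀ le_rfl)

end TimeBound

/-! ## §A2 `S₁` is cosmetic; §B1 the per-volume variant is trivial; §B2 no uniform constant -/

section Bookkeeping

variable {G : Type} [Group G] [TopologicalSpace G] [IsTopologicalGroup G] [CompactSpace G]
  [MeasurableSpace G] [BorelSpace G]

/-- Finitely many separations are always absorbed: for any real sequence `a` and any `m`, on the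
finite set `n ≤ S` one has `|a n| ≤ (Σ_{n' ≤ S} |a n'| e^{m n'}) e^{-m n}`. [folklore] -/
theorem abs_le_sum_mul_exp (a : ℕ → ℝ) (m : ℝ) (S n : ℕ) (hn : n ≤ S) :
    |a n| ≤ (∑ n' ∈ Finset.range (S + 1), |a n'| * Real.exp (m * n')) * Real.exp (-(m * n)) := by
  have hmem : n ∈ Finset.range (S + 1) := Finset.mem_range.2 (Nat.lt_succ_of_le hn)
  have hle : |a n| * Real.exp (m * n) ≤ ∑ n' ∈ Finset.range (S + 1), |a n'| * Real.exp (m * n') :=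
    Finset.single_le_sum (f := fun n' => |a n'| * Real.exp (m * n'))
      (fun n' _ => mul_nonneg (abs_nonneg _) (Real.exp_nonneg _)) hmem
  have hexp : Real.exp (m * n) * Real.exp (-(m * n)) = 1 := by
    rw [← Real.exp_add, add_neg_cancel, Real.exp_zero]
  calc |a n| = |a n| * Real.exp (m * n) * Real.exp (-(m * n)) := by
        rw [mul_assoc, hexp, mul_one]
    _ ≤ _ := mul_le_mul_of_nonneg_right hle (Real.exp_nonneg _)

/-- **B1. The per-volume variant is trivially TRUE** (every `G`, `r`, `β`, `m`, no hypothesis on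
the group at all): if `C` may depend on the torus, `n ≤ S` leaves finitely many separations. The
entire content of the crux is the `S`-uniformity of `C(A, B)`. [folklore] -/
theorem perVolume_trivial {N : ℕ} (ρ : G →* Matrix (Fin N) (Fin N) ℂ) (β m : ℝ)
    (A B : LGConfig 4 G → ℝ) (S : ℕ) :
    ∃ C : ℝ, ∀ n : ℕ, n ≤ S →
      |latticeConnectedCorr ρ β (2 * S + 1) A B n| ≤ C * Real.exp (-(m * n)) :=
  ⟨_, fun n hn => abs_le_sum_mul_exp (fun n => latticeConnectedCorr ρ β (2 * S + 1) A B n) m S n hn⟩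

/-- **A2. `S₁` is cosmetic**: at fixed `(r, β, m)` the clustering body with `∃ S₁, … S₁ ≤ S → n ≤ S →`
is EQUIVALENT to the body with `S₁` deleted — the finitely many pairs `n ≤ S < S₁` are absorbed
into `C(A, B)`. So "large tori only" is not a hypothesis a proof can exploit; small tori are in the
statement and harmless only because of `n ≤ S`. [folklore] -/
theorem clustering_iff_noS₁ {N : ℕ} (ρ : G →* Matrix (Fin N) (Fin N) ℂ) (β m : ℝ) :
    (∃ S₁ : ℕ, ∀ A B : YMSpecies G, ∃ C : ℝ, ∀ S n : ℕ, S₁ ≤ S → n ≤ S →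
      |latticeConnectedCorr ρ β (2 * S + 1) A.F B.F n| ≤ C * Real.exp (-(m * n))) ↔
    (∀ A B : YMSpecies G, ∃ C : ℝ, ∀ S n : ℕ, n ≤ S →
      |latticeConnectedCorr ρ β (2 * S + 1) A.F B.F n| ≤ C * Real.exp (-(m * n))) := by
  constructor
  · rintro ⟨S₁, h⟩ A B
    obtain ⟨C, hC⟩ := h A B
    set D : ℝ := ∑ S ∈ Finset.range S₁, ∑ n' ∈ Finset.range (S + 1),
      |latticeConnectedCorr ρ β (2 * S + 1) A.F B.F n'| * Real.exp (m * n') with hD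
    refine ⟨max C D, fun S n hn => ?_⟩
    by_cases hS : S₁ ≤ S
    · exact (hC S n hS hn).trans
        (mul_le_mul_of_nonneg_right (le_max_left _ _) (Real.exp_nonneg _))
    · have hSmem : S ∈ Finset.range S₁ := Finset.mem_range.2 (not_le.1 hS)
      have h1 := abs_le_sum_mul_exp (fun n => latticeConnectedCorr ρ β (2 * S + 1) A.F B.F n) m S n hn
      have h2 : (∑ n' ∈ Finset.range (S + 1),
          |latticeConnectedCorr ρ β (2 * S + 1) A.F B.F n'| * Real.exp (m * n')) ≤ D :=
        Finset.single_le_sum (f := fun S => ∑ n' ∈ Finset.range (S + 1),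
            |latticeConnectedCorr ρ β (2 * S + 1) A.F B.F n'| * Real.exp (m * n'))
          (fun S _ => Finset.sum_nonneg fun n' _ => mul_nonneg (abs_nonneg _) (Real.exp_nonneg _))
          hSmem
      exact h1.trans (mul_le_mul_of_nonneg_right (h2.trans (le_max_right _ _)) (Real.exp_nonneg _))
  · intro h
    exact ⟨0, fun A B => (h A B).imp fun C hC S n _ hn => hC S n hn⟩

/-- Scaling a gauge-invariant local observable by a real constant. [folklore] -/
def smulObs (c : ℝ) (A : LocalGaugeObservable 4 G) : LocalGaugeObservable 4 G where
  F := fun U => c * A.F U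
  supp := A.supp
  isCylinder := fun U V h => by
    show c * A.F U = c * A.F V
    rw [A.isCylinder h]
  gaugeInvariant := fun g U => by
    show c * A.F _ = c * A.F U
    rw [A.gaugeInvariant g U]
  bounded := by
    obtain ⟨C, hC⟩ := A.bounded
    exact ⟨|c| * C, fun U => by rw [abs_mul]; exact mul_le_mul_of_nonneg_left (hC U) (abs_nonneg _)⟩
  measurable := A.measurable.const_mul c

omit [IsTopologicalGroup G] [CompactSpace G] [BorelSpace G] [TopologicalSpace G] in
@[simp] theorem smulObs_F (c : ℝ) (A : LocalGaugeObservable 4 G) :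
    (smulObs c A).F = fun U => c * A.F U := rfl

/-- `corr` is bilinear: scaling both observables by `c` scales it by `c²` (pure algebra of the
Bochner integral, valid for every measure — junk-safe). [folklore] -/
theorem latticeConnectedCorr_smul {N : ℕ} (ρ : G →* Matrix (Fin N) (Fin N) ℂ) (β : ℝ) (L : ℕ)
    [NeZero L] (A B : LGConfig 4 G → ℝ) (c : ℝ) (n : ℕ) :
    latticeConnectedCorr ρ β L (fun U => c * A U) (fun U => c * B U) n =
      c ^ 2 * latticeConnectedCorr ρ β L A B n := by
  simp only [latticeConnectedCorr]
  have h1 : ∀ (U : GaugeConfig 4 L G),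
      c * A (torusLift L U) * (c * B (configShift (-Pi.single 0 (n : ℤ)) (torusLift L U))) =
        c ^ 2 * (A (torusLift L U) * B (configShift (-Pi.single 0 (n : ℤ)) (torusLift L U))) :=
    fun U => by ring
  simp_rw [h1, integral_const_mul]
  ring

/-- **B2. No constant uniform in the observables.** For every admissible `(G, r)` (only `∃ a ≠ 1`
is used), every `β`, `m` and `S₁`, there is NO single `C` serving all pairs `A, B`: scale the
plaquette, whose equal-time variance is `≥ v > 0` on every torus `S ≥ 1`
(`PoincareToGap.Negative.exists_cov_lower_bound`). So `C(A,B)` necessarily grows like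
`‖A‖∞‖B‖∞`; the crux's `∀ A B, ∃ C` order is the right one. [folklore] -/
theorem no_uniform_constant (hG : IsCompactSimpleLieGroup G) (r : LatticeRep G) (β m : ℝ) (S₁ : ℕ) :
    ¬ ∃ C : ℝ, ∀ A B : YMSpecies G, ∀ S n : ℕ, S₁ ≤ S → n ≤ S →
      |latticeConnectedCorr r.ρ β (2 * S + 1) A.F B.F n| ≤ C * Real.exp (-(m * n)) := by
  rintro ⟨C, hC⟩
  obtain ⟨g₀, hg₀⟩ := exists_ne_one hG
  obtain ⟨A, v, hv, hA⟩ := Summit.QuantumFields.YangMills.Theorems.PoincareToGap.Negative.exists_cov_lower_bound r hg₀ β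
  set S : ℕ := max S₁ 1 with hS
  have hvS := hA S (le_max_right _ _)
  -- choose the scale `c` with `c² v > C`
  obtain ⟨c, hc⟩ : ∃ c : ℝ, C < c ^ 2 * v := by
    refine ⟨Real.sqrt (|C| / v + 1), ?_⟩
    rw [Real.sq_sqrt (by positivity), add_mul, div_mul_cancel₀ _ hv.ne', one_mul]
    linarith [le_abs_self C]
  have h := hC (smulObs c A) (smulObs c A) S 0 (le_max_left _ _) (Nat.zero_le _)
  simp only [Nat.cast_zero, mul_zero, neg_zero, Real.exp_zero, mul_one] at h
  rw [smulObs_F, latticeConnectedCorr_smul, abs_mul, abs_pow, sq_abs] at h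
  have : c ^ 2 * v ≤ C := (mul_le_mul_of_nonneg_left hvS (sq_nonneg c)).trans h
  linarith

end Bookkeeping

/-! ## §A3 The non-abelian clause is load-bearing modulo abelian masslessness (`U(1)` witness) -/

section Circle

/-- `U(1) = Circle` with its charge-one representation is lattice representation DATA in the
crux's sense (faithful, continuous, unitary). [folklore] -/
@[reducible] def u1LatticeRep : LatticeRep Circle :=
  ⟨1, u1Rep, continuous_u1Rep, u1Rep_injective, u1Rep_mem_unitaryGroup⟩

@[simp] theorem u1LatticeRep_ρ : u1LatticeRep.ρ = u1Rep := rfl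

/-- **`U(1)` satisfies the closed-connected-normal-subgroup clause of `IsSimpleCompactGroup`.**
A preconnected subgroup `N` of the circle is `⊥` or `⊤`: if `1 ≠ w ∈ N` and `z ∉ N`, the chart
`u ↦ arg(−z⁻¹u)` is continuous and injective on `Circle ∖ {z} ⊇ N`, so `arg` maps `N` onto an
interval containing the distinct reals `ψ 1`, `ψ w`; the open arc over the open interval between
them lies in `N`, so `N` is an open subgroup of a connected group, i.e. `N = ⊤` — contradiction.
(Closedness is not even needed.) [folklore] -/
theorem circle_subgroup_eq_bot_or_top (N : Subgroup Circle)
    (hp : IsPreconnected (N : Set Circle)) : N = ⊥ ∨ N = ⊤ := by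
  by_contra hcon
  have hbot : N ≠ ⊥ := fun h => hcon (Or.inl h)
  have htop : N ≠ ⊤ := fun h => hcon (Or.inr h)
  obtain ⟨w, hwN, hw1⟩ : ∃ w ∈ N, w ≠ (1 : Circle) := by
    by_contra h'
    refine hbot ((Subgroup.eq_bot_iff_forall _).2 fun w hw => ?_)
    by_contra hw1
    exact h' ⟨w, hw, hw1⟩
  obtain ⟨z, hzN⟩ : ∃ z : Circle, z ∉ N := by
    by_contra h'
    refine htop ((Subgroup.eq_top_iff' _).2 fun z => ?_)
    by_contra hz
    exact h' ⟨z, hz⟩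
  -- the chart
  let φ : Circle → Circle := fun u => -(z⁻¹ * u)
  let ψ : Circle → ℝ := fun u => Complex.arg ((φ u : Circle) : ℂ)
  have hφ1 : ∀ u : Circle, φ u = -1 ↔ u = z := fun u => by
    show -(z⁻¹ * u) = -1 ↔ u = z
    rw [neg_inj, inv_mul_eq_one, eq_comm]
  have hslit : ∀ u : Circle, u ≠ z → ((φ u : Circle) : ℂ) ∈ Complex.slitPlane := by
    intro u hu
    rw [Complex.mem_slitPlane_iff_arg]
    refine ⟨fun harg => hu ((hφ1 u).1 ?_), Circle.coe_ne_zero _⟩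
    have : Complex.arg ((φ u : Circle) : ℂ) = Complex.arg (((-1 : Circle)) : ℂ) := by
      rw [harg, Circle.coe_neg, Circle.coe_one, Complex.arg_neg_one]
    exact Circle.arg_eq_arg.1 this
  have hφcont : Continuous φ := (continuous_const.mul continuous_id).neg
  have hφc : Continuous fun u : Circle => ((φ u : Circle) : ℂ) :=
    continuous_subtype_val.comp hφcont
  have hψ : ContinuousOn ψ {z}ᶜ := fun u hu => by
    have h1 : ContinuousAt (fun u : Circle => ((φ u : Circle) : ℂ)) u := hφc.continuousAt
    have h2 : ContinuousAt Complex.arg ((φ u : Circle) : ℂ) := Complex.continuousAt_arg (hslit u hu)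
    exact (h2.comp_of_eq h1 rfl).continuousWithinAt
  have hψinj : Injective ψ := fun u v h => by
    have h' : φ u = φ v := Circle.arg_eq_arg.1 h
    have h'' : z⁻¹ * u = z⁻¹ * v := neg_inj.1 h'
    exact mul_left_cancel h''
  have hNsub : (N : Set Circle) ⊆ {z}ᶜ := fun u hu hz => hzN (by
    rw [Set.mem_singleton_iff] at hz; rwa [hz] at hu)
  have hord : Set.OrdConnected (ψ '' (N : Set Circle)) :=
    isPreconnected_iff_ordConnected.1 (hp.image ψ (hψ.mono hNsub))
  have hab : ψ 1 ≠ ψ w := fun h => hw1 (hψinj h).symm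
  obtain ⟨lo, hi, hlohi, hIcc⟩ :
      ∃ lo hi : ℝ, lo < hi ∧ Set.Icc lo hi ⊆ ψ '' (N : Set Circle) := by
    rcases lt_or_gt_of_ne hab with hlt | hlt
    · exact ⟨_, _, hlt, hord.out (Set.mem_image_of_mem ψ N.one_mem) (Set.mem_image_of_mem ψ hwN)⟩
    · exact ⟨_, _, hlt, hord.out (Set.mem_image_of_mem ψ hwN) (Set.mem_image_of_mem ψ N.one_mem)⟩
  -- the open arc over `(lo, hi)` lies in `N`
  set arc : Set Circle := {z}ᶜ ∩ ψ ⁻¹' Set.Ioo lo hi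
  have harc_open : IsOpen arc := hψ.isOpen_inter_preimage isOpen_compl_singleton isOpen_Ioo
  have harc_sub : arc ⊆ (N : Set Circle) := by
    rintro u ⟨-, hu⟩
    obtain ⟨v, hvN, hv⟩ := hIcc (Set.Ioo_subset_Icc_self hu)
    rwa [← hψinj hv]
  have harc_ne : arc.Nonempty := by
    have hmid : (lo + hi) / 2 ∈ Set.Icc lo hi := ⟨by linarith, by linarith⟩
    obtain ⟨v, hvN, hv⟩ := hIcc hmid
    refine ⟨v, hNsub hvN, ?_⟩
    show ψ v ∈ Set.Ioo lo hi
    rw [hv]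
    exact ⟨by linarith, by linarith⟩
  obtain ⟨v, hv⟩ := harc_ne
  have hopen : IsOpen (N : Set Circle) :=
    N.isOpen_of_mem_nhds (Filter.mem_of_superset (harc_open.mem_nhds hv) harc_sub)
  have hclosed : IsClosed (N : Set Circle) := N.isClosed_of_isOpen hopen
  have hclopen : IsClopen (N : Set Circle) := ⟨hclosed, hopen⟩
  have huniv : (N : Set Circle) = Set.univ := hclopen.eq_univ ⟨1, N.one_mem⟩
  exact htop (Subgroup.coe_eq_univ.1 huniv)

/-- **`U(1)` is not simply connected** (`π₁(S¹) = ℤ`): the loop `t ↦ e^{2πit}` has the real lift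
`t ↦ 2πt` of its `ℝ/2πℤ`-valued coordinate, which does not close up (tree:
`AddCircle.not_simplyConnectedSpace_of_lift`, Hatcher Prop. 1.30 / Thm. 1.7). [folklore] -/
theorem not_simplyConnectedSpace_circle : ¬ SimplyConnectedSpace Circle := by
  let g : C(Circle, AddCircle (2 * Real.pi)) :=
    ⟨AddCircle.homeomorphCircle'.symm, AddCircle.homeomorphCircle'.symm.continuous⟩
  let γ : Path (1 : Circle) 1 :=
    { toFun := fun t => Circle.exp (2 * Real.pi * t)
      continuous_toFun := Circle.exp.continuous.comp (continuous_const.mul continuous_subtype_val)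
      source' := by simp
      target' := by simp }
  refine Literature.AlgebraicTopology.FundamentalGroup.AddCircle.not_simplyConnectedSpace_of_lift
    g γ (G := fun t => 2 * Real.pi * t) (continuous_const.mul continuous_subtype_val)
    (fun t => ?_) ?_
  · show ((2 * Real.pi * t : ℝ) : AddCircle (2 * Real.pi)) =
      AddCircle.homeomorphCircle'.symm (Circle.exp (2 * Real.pi * t))
    exact ((AddCircle.homeomorphCircle'.symm_apply_eq).2
      (AddCircle.homeomorphCircle'_apply_mk _).symm).symm
  · show (2 * Real.pi * (1 : ℝ)) ≠ 2 * Real.pi * (0 : ℝ)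
    simp [Real.pi_ne_zero]

/-- **The crux's hypotheses at `U(1)`**: `Circle` with its Borel σ-algebra passes every clause of
`IsCompactSimpleLieGroup` except `∃ a b, a * b ≠ b * a`, passes `¬ SimplyConnectedSpace`, and
carries a faithful unitary lattice representation. [folklore] -/
theorem circle_passes_all_but_nonAbelian :
    ConnectedSpace Circle ∧
      (∀ N : Subgroup Circle, N.Normal → IsClosed (N : Set Circle) →
        IsPreconnected (N : Set Circle) → N = ⊥ ∨ N = ⊤) ∧
      Nonempty (LatticeRep Circle) ∧ ¬ SimplyConnectedSpace Circle ∧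
      ¬ (∃ a b : Circle, a * b ≠ b * a) :=
  ⟨inferInstance, fun N _ _ hp => circle_subgroup_eq_bot_or_top N hp, ⟨u1LatticeRep⟩,
    not_simplyConnectedSpace_circle, fun ⟨a, b, h⟩ => h (mul_comm a b)⟩

/-- HYPOTHESIS `H` of the negative lemma A3 — **Wilson-action `U(1)₄` has no volume-uniform torus
mass gap at weak coupling** (the crux's clustering body, negated, at `G = U(1)`, `r = u1Rep`, for
arbitrarily large `β`): for every `β₀` there is `β ≥ β₀` at which no rate `m > 0`, threshold `S₁`
and constants `C(A,B)` give `|corr_S(A,B,n)| ≤ C e^{-mn}` for all gauge-invariant local `A, B`, all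
tori `(2S+1)⁴`, `S ≥ S₁`, `n ≤ S`. This is the torus / time-axis transcription of the Coulomb
(massless-photon) phase of four-dimensional compact `U(1)` lattice gauge theory: PRINTED for the
Villain action and the free-boundary state (Fröhlich–Spencer 1982 §2.11, "cannot have summable
fall-off"; Guth 1980), ASSERTED without proof for Wilson's action (FS82 p. 433 with fn. 3), reported
as established by Montvay–Münster 1994 §3.7.1 item 4.1; the tree registers the infinite-volume
Wilson forms as OPEN conjectures (`Literature.Barriers.QuantumFields.AbelianMasslessPhaseD4`,
`AbelianPlaquetteMasslessD4`) — the present torus form is likewise open (expected TRUE), neither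
implied by nor implying those (time-axis vs `‖x‖∞` decay; tori vs limit states). NOT constructible
here: it is a weak-coupling infrared theorem for `U(1)₄` with Wilson's action.
[topic Literature/MathematicalPhysics/QuantumFieldTheory]
[cite: FrohlichSpencerCMP1982, §2.11 pp. 433–437 with fn. 3 (Villain action; Wilson asserted p. 433)]
[cite: MontvayMunster1994, §3.7.1 item 4.1 (PDF p. 164)] [cite: Guth1980, title theorem] -/
def U1WilsonTorusMasslessD4 : Prop :=
  ∀ β₀ : ℝ, ∃ β : ℝ, β₀ ≤ β ∧ ¬ (∃ m : ℝ, 0 < m ∧ ∃ S₁ : ℕ, ∀ A B : YMSpecies Circle, ∃ C : ℝ,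
    ∀ S n : ℕ, S₁ ≤ S → n ≤ S →
    |latticeConnectedCorr u1Rep β (2 * S + 1) A.F B.F n| ≤ C * Real.exp (-(m * n)))

/-- **A3. The non-abelian clause is load-bearing (modulo `U1WilsonTorusMasslessD4`).** The crux
with `∃ a b, a * b ≠ b * a` deleted from `IsSimpleCompactGroup` — everything else verbatim
(connected; every closed preconnected normal subgroup `⊥` or `⊤`; a faithful unitary
representation exists; `¬ SimplyConnectedSpace`) — is FALSE if Wilson `U(1)₄` is massless on tori at
weak coupling: `G = U(1)` passes all remaining clauses (`circle_passes_all_but_nonAbelian`). So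
the only clause of the crux separating it from the abelian Coulomb phase (barrier
`AbelianDeconfinementD4`, technique class group-blind) is non-abelianness: any proof must use it.
[folklore] -/
theorem false_without_nonAbelian_of_u1Massless (hU : U1WilsonTorusMasslessD4) :
    ¬ (∀ (G : Type) [Group G] [TopologicalSpace G] [IsTopologicalGroup G] [CompactSpace G]
      [MeasurableSpace G] [BorelSpace G],
      (ConnectedSpace G ∧ (∀ N : Subgroup G, N.Normal → IsClosed (N : Set G) →
          IsPreconnected (N : Set G) → N = ⊥ ∨ N = ⊤) ∧ Nonempty (LatticeRep G)) →
      ¬ SimplyConnectedSpace G →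
      ∀ r : LatticeRep G, ∃ β₀ : ℝ, ∀ β : ℝ, β₀ ≤ β → ∃ m : ℝ, 0 < m ∧ ∃ S₁ : ℕ,
      ∀ A B : YMSpecies G, ∃ C : ℝ, ∀ S n : ℕ, S₁ ≤ S → n ≤ S →
      |latticeConnectedCorr r.ρ β (2 * S + 1) A.F B.F n| ≤ C * Real.exp (-(m * n))) := by
  intro h
  obtain ⟨hc, hs, hne, hnsc, -⟩ := circle_passes_all_but_nonAbelian
  obtain ⟨β₀, hβ₀⟩ := h Circle ⟨hc, hs, hne⟩ hnsc u1LatticeRep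
  obtain ⟨β, hb, hno⟩ := hU β₀
  exact hno (hβ₀ β hb)

/-- Sanity: the variant refuted in A3 is a WEAKENING of the crux's hypotheses (hence a
strengthening of the crux): it implies the crux. -/
theorem crux_of_withoutNonAbelian
    (h : ∀ (G : Type) [Group G] [TopologicalSpace G] [IsTopologicalGroup G] [CompactSpace G]
      [MeasurableSpace G] [BorelSpace G],
      (ConnectedSpace G ∧ (∀ N : Subgroup G, N.Normal → IsClosed (N : Set G) →
          IsPreconnected (N : Set G) → N = ⊥ ∨ N = ⊤) ∧ Nonempty (LatticeRep G)) →
      ¬ SimplyConnectedSpace G →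
      ∀ r : LatticeRep G, ∃ β₀ : ℝ, ∀ β : ℝ, β₀ ≤ β → ∃ m : ℝ, 0 < m ∧ ∃ S₁ : ℕ,
      ∀ A B : YMSpecies G, ∃ C : ℝ, ∀ S n : ℕ, S₁ ≤ S → n ≤ S →
      |latticeConnectedCorr r.ρ β (2 * S + 1) A.F B.F n| ≤ C * Real.exp (-(m * n))) :
    Summit.QuantumFields.YangMills.Theses.ConvexGribovBody.NonSimplyConnectedLatticeGap :=
  fun G _ _ _ _ _ _ hG hnsc r => h G ⟨hG.1.1, hG.1.2.2, hG.2⟩ hnsc r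

end Circle

/-! ## §A4 The intended witness class: `SO(3)` is not simply connected (tree: `π₁(SO(3)) = ℤ/2`) -/

section SO3

open Literature.AlgebraicTopology.FundamentalGroup in
/-- `SO(3)` is not simply connected: a simply connected space has trivial fundamental group,
while `π₁(SO(3), 1)` has two elements (`SO3.card_fundamentalGroup`, proved in the tree from the
universal cover `S³ → SO(3)`). Together with a unitary embedding and simplicity of `𝔰𝔬(3)` (not in
the tree) this is the first group the crux speaks about. [cite: HatcherAT2002, §3.D] -/
theorem not_simplyConnectedSpace_SO3 : ¬ SimplyConnectedSpace SO3 := by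
  intro hsc
  haveI : Subsingleton (FundamentalGroup SO3 1) :=
    ⟨fun a b => (inferInstance : Subsingleton (Path.Homotopic.Quotient (1 : SO3) 1)).elim a b⟩
  have h1 : Nat.card (FundamentalGroup SO3 1) = 1 :=
    Nat.card_of_subsingleton (1 : FundamentalGroup SO3 1)
  have h2 := SO3.card_fundamentalGroup
  omega

end SO3

/-! ## §D Targets (lead's skeleton `Sketch`, 3 stubs) — checked by hand, nothing to kill

`stub_sectorIdentity` (exact sector bookkeeping, finite measurable partition `E_k` of a probability
space, `p_k = μ(E_k)`, `I_k(F) = ∫_{E_k} F`, junk convention `0⁻¹ = 0`):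
`∫AB − ∫A∫B = Σ_k (I_k(AB) − p_k⁻¹ I_k(A) I_k(B)) + ½ Σ_{k,k'} p_k⁻¹ p_{k'}⁻¹ (p_{k'} I_k A − p_k I_{k'} A)(p_{k'} I_k B − p_k I_{k'} B)`.
CHECK: expanding the product and using `Σ_{k'} p_{k'} = 1`, `Σ_k I_k(F) = ∫F` gives
`½ Σ = Σ_k I_k(A)I_k(B)/p_k − ∫A∫B`, so the right side telescopes to the left side; at a null part
`p_k = 0` one has `I_k(F) = 0` for integrable `F` and every term carrying `p_k⁻¹ = 0` or `I_k = 0`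
vanishes on both sides, while `Σ_{k ∉ null} p_k = 1` still holds — the identity is TRUE as typed
(no `p_k ≠ 0` side condition needed). `stub_cellAnalyticityNSC` is the `π₁ ≠ 0`, frame-bound-1
restriction of item 16178 (complete analyticity at large scales): crux-strength, its only cheap
instances (`Y = {centre cell}`: difference `0`; `β = 0`: product Haar, difference `0`) hold; no
small model exists for the same reason as for the crux. `stub_cruxOfCellAnalyticityNSC` is proved
in the skeleton (the CA funnel through `FiniteSizeCriterion_proof`). -/

end Summit.QuantumFields.YangMills.Cruxes.NonSimplyConnectedLatticeGap.Disproof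

end
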